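import Summits.BirchSwinnertonDyer.Rank1Residual.X11b.BDPRouteRelaxation
import HarnessLib

/-!
# Route `GenusKolyvaginAtTwo`, LINES 18/19 (L_T stmt-BirchSwinnertonDyer-23242, L⁺_T stmt-23379), step (b) input I6:
# THE TWO-PLACE FORM OF POITOU–TATE RECIPROCITY — `⟨x, y⟩_{v₁} + ⟨x, y⟩_{v₂} = 0` when every other local term vanishes

Width seat `bsd-line-gk2-p4` g16 (cell `bsd-f1-sign2`), `--supports stmt-BirchSwinnertonDyer-23242` (helper; closes nothing).
THEOREMS ONLY: no definition, no named fact, no `sorry`; standard axioms.  BSD is NOT proved by any of this.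

WHY.  Input I6 of the 3a⁗ swap oracle (gk2-p2 g15 `Cruxes/PowDvdShaCardAtTwoRT/Lines/plus-descent-step-b-prop52.md` §1):
«two-place reciprocity: `Σ_v inv_v(c(nl′)_v ∪ c_v) = 0` with all terms off `{λ₀, λ′}` zero ⇒ the two terms agree — sum
formula PROVED for every number field (`poitouTate_sum_localTatePairing_eq_zero_holds`); two-exception form: trivial corollary,
not typed».  McCallum [McCallumLMS1991, §2 Prop. 2.2 and §5 (13), p. 309]: «`Σ_v inv_v(c_v ∪ c′_v) = 0` … the terms for
`v ∉ {λ₀, λ′}` vanish … so the `λ₀`-term is non-zero».  Typed here in the `invWeilPairing` currency of X11b / the auxiliary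
class files, for any number field `K`, any elliptic `W`, any level `n`, any Weil datum and any family `inv` with
`SumLocalTermEqZero` (the Literature lemma `sum_inv_weilCupProduct_localization_eq_zero` on `S = {v₁, v₂}`).

WHAT (namespace `…Theorems.GenusExact.AuxiliaryClass`): `invWeilPairing_add_eq_zero_of_forall_ne` (the two terms sum to zero),
`invWeilPairing_eq_neg_of_forall_ne`, `invWeilPairing_eq_zero_iff_of_forall_ne` (one vanishes iff the other does),
`invWeilPairing_ne_zero_of_forall_ne` (McCallum's use: the `λ′`-term is non-zero ⇒ so is the `λ₀`-term).

References: [McCallumLMS1991] §2 Prop. 2.2, §5 (13); [MilneADT2006] Ch. I Thm. 4.10(b).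
-/

set_option autoImplicit false
-- the Theorems namespace of this sub repeats the summit name by design (D-0017 nested layout)
set_option linter.dupNamespace false

noncomputable section

open scoped Classical

open Field NumberField IsDedekindDomain Function
open Literature.NumberTheory.EllipticCurves
open Literature.NumberTheory.GaloisRepresentations
open Literature.NumberTheory.GaloisCohomology
open Summit.BirchSwinnertonDyer.Rank1Residual.X11b.Relaxation

namespace Summit.BirchSwinnertonDyer.BirchSwinnertonDyer.Theorems.GenusExact.AuxiliaryClass

universe u

variable {K : Type u} [Field K] [NumberField K] (W : WeierstrassCurve K) [W.IsElliptic] (n : ℕ) [NeZero n]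

variable (e : W.geomTorsion n → W.geomTorsion n → AlgebraicClosure K)
  (hμ : ∀ S T, e S T ^ n = 1)
  (hadd₁ : ∀ S₁ S₂ T, e (S₁ + S₂) T = e S₁ T * e S₂ T)
  (hadd₂ : ∀ S T₁ T₂, e S (T₁ + T₂) = e S T₁ * e S T₂)
  (hgal : ∀ (σ : absoluteGaloisGroup K) (S T : W.geomTorsion n), σ • e S T = e (σ • S) (σ • T))

/-- **Two-place reciprocity**: for global classes `x, y ∈ H¹(K, E[n])` whose local terms `inv_v(loc_v x ∪ₑ loc_v y)` vanish at
every place other than `v₁ ≠ v₂`, the two remaining terms sum to zero (Poitou–Tate `Σ_v ⟨x, y⟩_v = 0` on `S = {v₁, v₂}`).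
[cite: McCallumLMS1991, §2 Prop. 2.2] [cite: MilneADT2006, Ch. I, Thm. 4.10(b)] -/
theorem invWeilPairing_add_eq_zero_of_forall_ne (inv : LocalInvariants K n) (hsum : inv.SumLocalTermEqZero)
    (x y : galoisCohomology (W.torsionGaloisModule (n : ℤ)) 1) {v₁ v₂ : Place K} (hne : v₁ ≠ v₂)
    (hS : ∀ v : Place K, v ≠ v₁ → v ≠ v₂ →
      invWeilPairing W n e hμ hadd₁ hadd₂ hgal inv v
        (galoisCohomology.localization (W.torsionGaloisModule (n : ℤ)) v 1 x)
        (galoisCohomology.localization (W.torsionGaloisModule (n : ℤ)) v 1 y) = 0) :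
    invWeilPairing W n e hμ hadd₁ hadd₂ hgal inv v₁
        (galoisCohomology.localization (W.torsionGaloisModule (n : ℤ)) v₁ 1 x)
        (galoisCohomology.localization (W.torsionGaloisModule (n : ℤ)) v₁ 1 y) +
      invWeilPairing W n e hμ hadd₁ hadd₂ hgal inv v₂
        (galoisCohomology.localization (W.torsionGaloisModule (n : ℤ)) v₂ 1 x)
        (galoisCohomology.localization (W.torsionGaloisModule (n : ℤ)) v₂ 1 y) = 0 := by
  classical
  have h := sum_inv_weilCupProduct_localization_eq_zero W n e hμ hadd₁ hadd₂ hgal inv hsum x y {v₁, v₂}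
    (fun v hv ↦ by
      rw [Finset.mem_insert, Finset.mem_singleton, not_or] at hv
      have h' := hS v hv.1 hv.2
      rwa [invWeilPairing_apply] at h')
  rw [Finset.sum_pair hne] at h
  simpa only [invWeilPairing_apply] using h

/-- Two-place reciprocity, solved form: `⟨x, y⟩_{v₁} = −⟨x, y⟩_{v₂}`. [cite: McCallumLMS1991, §2 Prop. 2.2 and §5 (13)] -/
theorem invWeilPairing_eq_neg_of_forall_ne (inv : LocalInvariants K n) (hsum : inv.SumLocalTermEqZero)
    (x y : galoisCohomology (W.torsionGaloisModule (n : ℤ)) 1) {v₁ v₂ : Place K} (hne : v₁ ≠ v₂)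
    (hS : ∀ v : Place K, v ≠ v₁ → v ≠ v₂ →
      invWeilPairing W n e hμ hadd₁ hadd₂ hgal inv v
        (galoisCohomology.localization (W.torsionGaloisModule (n : ℤ)) v 1 x)
        (galoisCohomology.localization (W.torsionGaloisModule (n : ℤ)) v 1 y) = 0) :
    invWeilPairing W n e hμ hadd₁ hadd₂ hgal inv v₁
        (galoisCohomology.localization (W.torsionGaloisModule (n : ℤ)) v₁ 1 x)
        (galoisCohomology.localization (W.torsionGaloisModule (n : ℤ)) v₁ 1 y) =
      -invWeilPairing W n e hμ hadd₁ hadd₂ hgal inv v₂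
        (galoisCohomology.localization (W.torsionGaloisModule (n : ℤ)) v₂ 1 x)
        (galoisCohomology.localization (W.torsionGaloisModule (n : ℤ)) v₂ 1 y) :=
  eq_neg_of_add_eq_zero_left (invWeilPairing_add_eq_zero_of_forall_ne W n e hμ hadd₁ hadd₂ hgal inv hsum x y hne hS)

/-- Two-place reciprocity, vanishing form: `⟨x, y⟩_{v₁} = 0 ↔ ⟨x, y⟩_{v₂} = 0`. [cite: McCallumLMS1991, §5 (13)] -/
theorem invWeilPairing_eq_zero_iff_of_forall_ne (inv : LocalInvariants K n) (hsum : inv.SumLocalTermEqZero)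
    (x y : galoisCohomology (W.torsionGaloisModule (n : ℤ)) 1) {v₁ v₂ : Place K} (hne : v₁ ≠ v₂)
    (hS : ∀ v : Place K, v ≠ v₁ → v ≠ v₂ →
      invWeilPairing W n e hμ hadd₁ hadd₂ hgal inv v
        (galoisCohomology.localization (W.torsionGaloisModule (n : ℤ)) v 1 x)
        (galoisCohomology.localization (W.torsionGaloisModule (n : ℤ)) v 1 y) = 0) :
    invWeilPairing W n e hμ hadd₁ hadd₂ hgal inv v₁
        (galoisCohomology.localization (W.torsionGaloisModule (n : ℤ)) v₁ 1 x)
        (galoisCohomology.localization (W.torsionGaloisModule (n : ℤ)) v₁ 1 y) = 0 ↔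
      invWeilPairing W n e hμ hadd₁ hadd₂ hgal inv v₂
        (galoisCohomology.localization (W.torsionGaloisModule (n : ℤ)) v₂ 1 x)
        (galoisCohomology.localization (W.torsionGaloisModule (n : ℤ)) v₂ 1 y) = 0 := by
  rw [invWeilPairing_eq_neg_of_forall_ne W n e hμ hadd₁ hadd₂ hgal inv hsum x y hne hS, neg_eq_zero]

/-- **McCallum's use of (13)**: if every local term off `{v₁, v₂}` vanishes and the `v₂`-term is NON-ZERO, then the
`v₁`-term is non-zero («hence the `λ₀`-term is non-zero, so `c_{M_r+1}(nl′)_{λ₀} ≠ 0`», Prop. 5.2's swap step).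
[cite: McCallumLMS1991, §5 (13), proof of Prop. 5.2] -/
theorem invWeilPairing_ne_zero_of_forall_ne (inv : LocalInvariants K n) (hsum : inv.SumLocalTermEqZero)
    (x y : galoisCohomology (W.torsionGaloisModule (n : ℤ)) 1) {v₁ v₂ : Place K} (hne : v₁ ≠ v₂)
    (hS : ∀ v : Place K, v ≠ v₁ → v ≠ v₂ →
      invWeilPairing W n e hμ hadd₁ hadd₂ hgal inv v
        (galoisCohomology.localization (W.torsionGaloisModule (n : ℤ)) v 1 x)
        (galoisCohomology.localization (W.torsionGaloisModule (n : ℤ)) v 1 y) = 0)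
    (hv₂ : invWeilPairing W n e hμ hadd₁ hadd₂ hgal inv v₂
        (galoisCohomology.localization (W.torsionGaloisModule (n : ℤ)) v₂ 1 x)
        (galoisCohomology.localization (W.torsionGaloisModule (n : ℤ)) v₂ 1 y) ≠ 0) :
    invWeilPairing W n e hμ hadd₁ hadd₂ hgal inv v₁
        (galoisCohomology.localization (W.torsionGaloisModule (n : ℤ)) v₁ 1 x)
        (galoisCohomology.localization (W.torsionGaloisModule (n : ℤ)) v₁ 1 y) ≠ 0 :=
  fun h ↦ hv₂ ((invWeilPairing_eq_zero_iff_of_forall_ne W n e hμ hadd₁ hadd₂ hgal inv hsum x y hne hS).mp h)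

end Summit.BirchSwinnertonDyer.BirchSwinnertonDyer.Theorems.GenusExact.AuxiliaryClass

end
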